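import Summits.ValiantsHypothesis.ValiantsHypothesis.Theorems.LacunarySymmetroidMatrixDescartesCensusNineteenKit
import Summits.ValiantsHypothesis.ValiantsHypothesis.Theorems.LacunarySymmetroidMatrixDescartesCensusSignClass

/-!
# `MatrixDescartes` census — kit for CASE C (one-collision supports) of the V = 19 layer of door A

HONEST FRAMING.  Object-search cell `pub-symmetroid`, route `LacunarySymmetroid`; door-A item `Theses.LacunarySymmetroid.DoorA26`
(stmt-ValiantsHypothesis-19979, `= PosRootLawAt 2 6 19`, OPEN, never asserted) and its sharper support rows `PosRootLawOn 2 6 18 d`.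
«Case C» (engine-3 g15's `casec.py`; scoping note `HOME/val-sym-door-p5/g2/CASEC-SCOPING-P5G2.md` §0/§3) is the class of six-term supports
`d` whose `21` pair sums `dᵢ + dⱼ` (`i ≤ j`) take exactly `20` values: ONE value `e⋆` is hit by two Gram labels `A, B` (pair + pair
`(i,j) & (k,l)`, or diagonal + pair `(m,m) & (i,j)`), so the coefficient of `det (Σ X^{d l} S l)` at `e⋆` is the COMPOSITE atom
`c⋆ = G_A + G_B`.  A hypothetical pencil with `19` distinct positive det-roots on such a support is Descartes-SHARP on the `20` exponents
(all coefficients non-zero, alternating), and the certificates branch on the decomposition of `c⋆`.  This file supplies the small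
generic lemmas that the per-cell kernel replays (file-per-cell route) and a certificate checker (reflective route) both consume, and
nothing else:

* DICTIONARY at a collided exponent — `coeff_det_pencil_two_diag_pair` (`c⋆ = det S_m + β(S_i,S_j)`) and `coeff_det_pencil_two_pair_pair`
  (`c⋆ = β(S_i,S_j) + β(S_k,S_l)`), companions of the tree's uncollided `coeff_det_pencil_two_diag/pair`;
* SHARPNESS bookkeeping — `support_eq_of_subset_of_card_le_posRoots_succ` / `caseC_support_eq` / `caseC_sharp`: `19` distinct positive roots
  and `supp f ⊆ E`, `#E = 20` force `supp f = E` (Descartes `#Z₊ < #supp`), which is the hypothesis shape of the tree's row lemmas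
  `newton_cone_coeff` (C25) and `pow_rank_mul_coeff_mul_coeff_pos_of_sharp` (F1);
* the SIX BRANCHES of a composite non-zero coefficient — `caseC_branches`: for reals `gA + gB = c ≠ 0` exactly engine-3's exhaustive split
  `ZA` (`gA = 0`) · `ZB` (`gB = 0`) · `PPa` (both of the sign of `c`, `|gB| ≤ |gA|`, whence `|gA| < |c| ≤ 2|gA|`) · `PPb` (swapped) ·
  `PM` (`gA` of the sign of `c`, `gB` opposite, whence `|gB| < |gA|`, `|c| < |gA|`) · `MP` (swapped), each disjunct carrying its sign facts
  (as products with `c`) and its LINK inequalities (the `LINK[…]` rows of `casec.py`, multiplicative form);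
* the DISPATCH `caseC_dispatch` = sharpness + `c⋆ ≠ 0` + the six branches, for a polynomial with `19` positive roots on a `20`-set, in the
  shape the per-support assemblies `rcases` on (pattern of `Census.caseB_or_caseA` for the 2-Sidon supports);
* sign extraction helpers `pos_of_mul_pos_of_pos'`-style one-liners are NOT duplicated (Mathlib: `pos_of_mul_pos_left`, `neg_of_mul_neg_left`, …).

Nothing here is a certificate, a support row or a format value; registers unchanged (`ζ_sym(2,6) ∈ {18,19,20}`, `18` attained); nothing on
`DoorA26` over all supports, on `MatrixDescartes` (stmt-ValiantsHypothesis-18050) or on `VP ≠ VNP`.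

[folklore] Elementary real arithmetic and `2 × 2` determinant bookkeeping.
-/

-- `Summit.ValiantsHypothesis.ValiantsHypothesis.…` repeats a component by the D-0017 layout
-- (single-conjunct summit), which the `dupNamespace` linter flags; the name is mandated.
set_option linter.dupNamespace false

namespace Summit.ValiantsHypothesis.ValiantsHypothesis.Theorems.LacunarySymmetroidMatrixDescartes.Census

open Polynomial Finset
open scoped BigOperators Polynomial Matrix

/-! ### Dictionary at a collided exponent -/

/-- **Diagonal + pair collision.**  If the exponent `e` is hit exactly by the labels `(m,m)`, `(i,j)`, `(j,i)` (`i ≠ j`, `d m + d m = e = d i + d j`),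
then the coefficient of `det (Σ X^{d l} S l)` at `e` is `det S_m + 2·B(S_i,S_j)` in entry coordinates. [folklore] -/
theorem coeff_det_pencil_two_diag_pair {K : ℕ} (d : Fin K → ℕ) (S : Fin K → Matrix (Fin 2) (Fin 2) ℝ)
    {e : ℕ} {m i j : Fin K} (hij : i ≠ j) (hmi : m ≠ i) (hmj : m ≠ j) (hm : d m + d m = e) (he : d i + d j = e)
    (huniq : ∀ p : Fin K × Fin K, d p.1 + d p.2 = e → p = (m, m) ∨ p = (i, j) ∨ p = (j, i)) :
    (∑ l, ((X : ℝ[X]) ^ d l) • (S l).map C).det.coeff e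
      = (S m 0 0 * S m 1 1 - S m 0 1 * S m 1 0)
        + ((S i 0 0 * S j 1 1 - S i 0 1 * S j 1 0) + (S j 0 0 * S i 1 1 - S j 0 1 * S i 1 0)) := by
  rw [coeff_det_pencil_two]
  have h1 : (m, m) ≠ (i, j) := fun h => hmi (Prod.mk.inj h).1
  have h2 : (m, m) ≠ (j, i) := fun h => hmj (Prod.mk.inj h).1
  have h3 : (i, j) ≠ (j, i) := fun h => hij (Prod.mk.inj h).1
  have hset : (Finset.univ : Finset (Fin K × Fin K)).filter (fun p => d p.1 + d p.2 = e)
      = {(m, m), (i, j), (j, i)} := by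
    ext p
    simp only [Finset.mem_filter, Finset.mem_univ, true_and, Finset.mem_insert, Finset.mem_singleton]
    refine ⟨huniq p, ?_⟩
    rintro (h | h | h) <;> rw [h]
    · exact hm
    · exact he
    · show d j + d i = e
      rw [add_comm]; exact he
  rw [hset, Finset.sum_insert (by simp [h1, h2]), Finset.sum_pair h3]

/-- **Pair + pair collision.**  If the exponent `e` is hit exactly by the labels `(i,j)`, `(j,i)`, `(k,l)`, `(l,k)` (`i ≠ j`, `k ≠ l`,
`{i,j} ≠ {k,l}` as needed for distinctness, `d i + d j = e = d k + d l`), then the coefficient of `det (Σ X^{d l} S l)` at `e` is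
`2·B(S_i,S_j) + 2·B(S_k,S_l)` in entry coordinates. [folklore] -/
theorem coeff_det_pencil_two_pair_pair {K : ℕ} (d : Fin K → ℕ) (S : Fin K → Matrix (Fin 2) (Fin 2) ℝ)
    {e : ℕ} {i j k l : Fin K} (hij : i ≠ j) (hkl : k ≠ l) (hik : i ≠ k) (hil : i ≠ l) (hjk : j ≠ k) (hjl : j ≠ l)
    (he1 : d i + d j = e) (he2 : d k + d l = e)
    (huniq : ∀ p : Fin K × Fin K, d p.1 + d p.2 = e → p = (i, j) ∨ p = (j, i) ∨ p = (k, l) ∨ p = (l, k)) :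
    (∑ q, ((X : ℝ[X]) ^ d q) • (S q).map C).det.coeff e
      = ((S i 0 0 * S j 1 1 - S i 0 1 * S j 1 0) + (S j 0 0 * S i 1 1 - S j 0 1 * S i 1 0))
        + ((S k 0 0 * S l 1 1 - S k 0 1 * S l 1 0) + (S l 0 0 * S k 1 1 - S l 0 1 * S k 1 0)) := by
  rw [coeff_det_pencil_two]
  have h1 : (i, j) ≠ (j, i) := fun h => hij (Prod.mk.inj h).1
  have h2 : (i, j) ≠ (k, l) := fun h => hik (Prod.mk.inj h).1
  have h3 : (i, j) ≠ (l, k) := fun h => hil (Prod.mk.inj h).1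
  have h4 : (j, i) ≠ (k, l) := fun h => hjk (Prod.mk.inj h).1
  have h5 : (j, i) ≠ (l, k) := fun h => hjl (Prod.mk.inj h).1
  have h6 : (k, l) ≠ (l, k) := fun h => hkl (Prod.mk.inj h).1
  have hset : (Finset.univ : Finset (Fin K × Fin K)).filter (fun p => d p.1 + d p.2 = e)
      = {(i, j), (j, i), (k, l), (l, k)} := by
    ext p
    simp only [Finset.mem_filter, Finset.mem_univ, true_and, Finset.mem_insert, Finset.mem_singleton]
    refine ⟨huniq p, ?_⟩
    rintro (h | h | h | h) <;> rw [h]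
    · exact he1
    · show d j + d i = e
      rw [add_comm]; exact he1
    · exact he2
    · show d l + d k = e
      rw [add_comm]; exact he2
  rw [hset, Finset.sum_insert (by simp [h1, h2, h3]), Finset.sum_insert (by simp [h4, h5]), Finset.sum_pair h6]
  ring

/-! ### Sharpness bookkeeping: `19` positive roots on a `20`-set -/

/-- If `supp f ⊆ E` and `#E ≤ #Z₊(f) + 1` for a non-zero real polynomial `f`, then `supp f = E` (Descartes: `#Z₊ < #supp`). [folklore] -/
theorem support_eq_of_subset_of_card_le_posRoots_succ (f : ℝ[X]) (hf : f ≠ 0) (E : Finset ℕ) (hsub : f.support ⊆ E)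
    (hE : E.card ≤ (f.roots.toFinset.filter (fun t => 0 < t)).card + 1) : f.support = E := by
  have hlt := Literature.Computability.AlgebraicComplexity.card_roots_toFinset_filter_pos_lt_card_support hf
  exact Finset.eq_of_subset_of_card_le hsub (by omega)

/-- **Case C support.**  `19` distinct positive roots and `supp f ⊆ E` with `#E = 20` force `supp f = E`. [folklore] -/
theorem caseC_support_eq (f : ℝ[X]) (E : Finset ℕ) (hE : E.card = 20) (hsub : f.support ⊆ E)
    (hZ : 19 ≤ (f.roots.toFinset.filter (fun t => 0 < t)).card) : f.support = E := by
  have hf : f ≠ 0 := by rintro rfl; simp at hZ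
  exact support_eq_of_subset_of_card_le_posRoots_succ f hf E hsub (by omega)

/-- **Case C sharpness** in the hypothesis shape of `newton_cone_coeff` / `pow_rank_mul_coeff_mul_coeff_pos_of_sharp`:
`#supp f ≤ #Z₊(f) + 1`. [folklore] -/
theorem caseC_sharp (f : ℝ[X]) (E : Finset ℕ) (hE : E.card = 20) (hsub : f.support ⊆ E)
    (hZ : 19 ≤ (f.roots.toFinset.filter (fun t => 0 < t)).card) :
    f.support.card ≤ (f.roots.toFinset.filter (fun t => 0 < t)).card + 1 := by
  rw [caseC_support_eq f E hE hsub hZ, hE]; omega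

/-! ### The six branches of a composite non-zero coefficient -/

/-- **The six branches** (`casec.py`: `ZA`, `ZB`, `PPa`, `PPb`, `PM`, `MP`).  For reals with `gA + gB = c ≠ 0`: either `gA = 0` (so `gB = c`),
or `gB = 0` (so `gA = c`), or both have the sign of `c` with `|gB| ≤ |gA|` (then `|gA| < |c| ≤ 2|gA|`), or the same with `A, B` swapped,
or `gA` has the sign of `c` and `gB` the opposite sign (then `|gB| < |gA|` and `|c| < |gA|`), or the same with `A, B` swapped.  Signs are
recorded as signs of the products with `c`. [folklore] -/
theorem caseC_branches {gA gB c : ℝ} (hc : gA + gB = c) (hc0 : c ≠ 0) :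
    (gA = 0 ∧ gB = c) ∨
    (gB = 0 ∧ gA = c) ∨
    (0 < gA * c ∧ 0 < gB * c ∧ |gB| ≤ |gA| ∧ |gA| < |c| ∧ |c| ≤ 2 * |gA|) ∨
    (0 < gA * c ∧ 0 < gB * c ∧ |gA| ≤ |gB| ∧ |gB| < |c| ∧ |c| ≤ 2 * |gB|) ∨
    (0 < gA * c ∧ gB * c < 0 ∧ |gB| < |gA| ∧ |c| < |gA|) ∨
    (gA * c < 0 ∧ 0 < gB * c ∧ |gA| < |gB| ∧ |c| < |gB|) := by
  subst hc
  rcases eq_or_ne gA 0 with hA | hA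
  · exact Or.inl ⟨hA, by rw [hA, zero_add]⟩
  rcases eq_or_ne gB 0 with hB | hB
  · exact Or.inr (Or.inl ⟨hB, by rw [hB, add_zero]⟩)
  rcases lt_or_gt_of_ne hA with hA' | hA' <;> rcases lt_or_gt_of_ne hB with hB' | hB'
  · -- gA < 0, gB < 0 : PPa or PPb
    have hc' : gA + gB < 0 := by linarith
    rw [abs_of_neg hA', abs_of_neg hB', abs_of_neg hc']
    rcases le_or_gt gA gB with h | h
    · exact Or.inr (Or.inr (Or.inl ⟨by nlinarith, by nlinarith, by linarith, by linarith, by linarith⟩))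
    · exact Or.inr (Or.inr (Or.inr (Or.inl ⟨by nlinarith, by nlinarith, by linarith, by linarith, by linarith⟩)))
  · -- gA < 0 < gB : PM or MP according to the sign of c
    rcases lt_or_gt_of_ne hc0 with hc' | hc'
    · -- c < 0: gA has the sign of c (PM)
      rw [abs_of_neg hA', abs_of_pos hB', abs_of_neg hc']
      exact Or.inr (Or.inr (Or.inr (Or.inr (Or.inl ⟨by nlinarith, by nlinarith, by linarith, by linarith⟩))))
    · -- 0 < c: gB has the sign of c (MP)
      rw [abs_of_neg hA', abs_of_pos hB', abs_of_pos hc']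
      exact Or.inr (Or.inr (Or.inr (Or.inr (Or.inr ⟨by nlinarith, by nlinarith, by linarith, by linarith⟩))))
  · -- gB < 0 < gA
    rcases lt_or_gt_of_ne hc0 with hc' | hc'
    · -- c < 0: gB has the sign of c (MP)
      rw [abs_of_pos hA', abs_of_neg hB', abs_of_neg hc']
      exact Or.inr (Or.inr (Or.inr (Or.inr (Or.inr ⟨by nlinarith, by nlinarith, by linarith, by linarith⟩))))
    · -- 0 < c: gA has the sign of c (PM)
      rw [abs_of_pos hA', abs_of_neg hB', abs_of_pos hc']
      exact Or.inr (Or.inr (Or.inr (Or.inr (Or.inl ⟨by nlinarith, by nlinarith, by linarith, by linarith⟩))))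
  · -- 0 < gA, 0 < gB : PPa or PPb
    have hc' : 0 < gA + gB := by linarith
    rw [abs_of_pos hA', abs_of_pos hB', abs_of_pos hc']
    rcases le_or_gt gB gA with h | h
    · exact Or.inr (Or.inr (Or.inl ⟨by nlinarith, by nlinarith, by linarith, by linarith, by linarith⟩))
    · exact Or.inr (Or.inr (Or.inr (Or.inl ⟨by nlinarith, by nlinarith, by linarith, by linarith, by linarith⟩)))

/-! ### Dispatch for a polynomial with `19` positive roots on a one-collision support -/

/-- **Case C dispatch.**  A real polynomial `f` with `19` distinct positive roots and `supp f ⊆ E`, `#E = 20`, whose coefficient at some `e ∈ E`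
decomposes as `gA + gB`: then `supp f = E`, the coefficient `c = f_e` is non-zero, and `(gA, gB, c)` lies in one of the six branches of
`caseC_branches` (with their sign and LINK facts).  This is what the per-support assemblies of the cell `rcases` on (two orientations ×
six branches = engine-3's `12` cells per support). [folklore] -/
theorem caseC_dispatch (f : ℝ[X]) (E : Finset ℕ) (hE : E.card = 20) (hsub : f.support ⊆ E)
    (hZ : 19 ≤ (f.roots.toFinset.filter (fun t => 0 < t)).card) {e : ℕ} (he : e ∈ E) {gA gB : ℝ}
    (hc : f.coeff e = gA + gB) :
    f.support = E ∧ f.coeff e ≠ 0 ∧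
    ((gA = 0 ∧ gB = f.coeff e) ∨
     (gB = 0 ∧ gA = f.coeff e) ∨
     (0 < gA * f.coeff e ∧ 0 < gB * f.coeff e ∧ |gB| ≤ |gA| ∧ |gA| < |f.coeff e| ∧ |f.coeff e| ≤ 2 * |gA|) ∨
     (0 < gA * f.coeff e ∧ 0 < gB * f.coeff e ∧ |gA| ≤ |gB| ∧ |gB| < |f.coeff e| ∧ |f.coeff e| ≤ 2 * |gB|) ∨
     (0 < gA * f.coeff e ∧ gB * f.coeff e < 0 ∧ |gB| < |gA| ∧ |f.coeff e| < |gA|) ∨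
     (gA * f.coeff e < 0 ∧ 0 < gB * f.coeff e ∧ |gA| < |gB| ∧ |f.coeff e| < |gB|)) := by
  have hsupp := caseC_support_eq f E hE hsub hZ
  have hne : f.coeff e ≠ 0 := mem_support_iff.mp (hsupp ▸ he)
  exact ⟨hsupp, hne, caseC_branches hc.symm hne⟩

/-- **Orientation.**  The sign `s` of the lowest coefficient of a sharp polynomial is `+` or `−` (the two orientations of every cell);
stated for any non-zero real. [folklore] -/
theorem orientation_split {q : ℝ} (hq : q ≠ 0) : 0 < q ∨ q < 0 := (lt_or_gt_of_ne hq).symm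

end Summit.ValiantsHypothesis.ValiantsHypothesis.Theorems.LacunarySymmetroidMatrixDescartes.Census
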